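import Mathlib
import HarnessLib
import Summits.HubbardSuperconductivity.HubbardSuperconductivity.Theorems.KLProgrammeKLRegimeEngineTowerBlockZeroBaseWtKlEngClosed

/-!
# Route `KLProgramme` — crux K3 ENGINE (stmt-HubbardSuperconductivity-20437 `KLRegimeEngineV17F2`), stub (b) v2, THE WEIGHTED HALF «(b)-WT4»:
# W11a — «WB4» part 1: THE WEIGHTED UNIT LAW OF `𝒱_{j}[K_n]` AT ITS OWN FAMILY `(F_{j}, rate j)` FOR EVERY BLOCK-0 LEVEL `1 ≤ j ≤ d`
# (cell gate-hubbard-kl, seat hubbard-kl-k3c3-p2 g17; p3 g22's WB3 `baseLawWtF_blockZero_klEng(_closed)` (p700691/p701078) RE-TARGETED from `(𝒱_d, F_{d−1})` to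
# `(𝒱_j, F_j)` — the proof is p3's, line by line, with the target moved; credited; E1 may rename or supersede)

On `K_n`, for a block-0 level `1 ≤ j ≤ d`, `j ≤ n`, rate `j` and `p ≥ 3`, every weighted pinned sum of `𝒱_j = 𝒱_1 + (𝒱_j − 𝒱_1)` at its own family `F_j` is read out from
(1) the level-`0` weighted datum `klTowerMeasWtAt … 1 1 j` of `𝒱_1` at `F_0` jumped ONCE to `F_j` (`klWtPinnedSumAt_jump_le_klEng_flow_all_uniform`, momentum
conservation of `𝒱_1`), and (2) the born weighted partial increment `𝒱_j − 𝒱_1` at `F_1` in floor units — p3's weighted partial-increment kit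
`klWtPinnedSumAt_partialIncr_le_kitStep_of_bounds` (WB1) at `(d, k, J₂, J′) := (1, 1, j, 1)` with the block-`0` Gram constant (`linkDataBlockZeroF_klEng d` at level
`j ≤ d`, rate-free), the weighted decay rows of the slice `(Λ_j, Λ_1]` at the fat family `F̃_0` (`alphaWt_blockZero_of_doors d`, level `j`, rate `j`) and the weighted
analysis overlaps of `E(F_1)·S(F̃_0)` (`overlapWt_towerBlock_klEng_flow_all 1` at rate `j`) all DISCHARGED — jumped once to `F_j` (`j ≥ 2`; read directly when `j = 1`);
every jump factor `(2^{Δ})^{2p−2}` against the floor-unit ratio is the pure gain `((2^{p−3})⁻¹)^{Δ} ≤ 1`, and E1 part 7 (`towerReadout_le_of_ro_mul`,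
`readoutBracket_le_law_mul_sharp`) puts the sum under ONE profile — exactly WB3's argument with `(d, F_{d−1})` replaced by `(j, F_j)`:
* **`levelLawWt_blockZero_klEng (d R c″)`** — `∃ C_inc D_inc ≥ 1, ∃ Cκ CJ Cα > 0`, `R.WF2 → ∃ c₃′ U₀′`; for `1 ≤ j ≤ d`, `j ≤ n`:
  ⊢ `klWtPinnedSum … (K_n) j (2p) q w / klLevUnitF β M 0 p j ≤ A_tot·λ^{p−1}·Q_tot^p` for EVERY `p ≥ 3` and every pin, `A_tot, Q_tot` by WB3's sharp read-out formulas.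
  ROWS THAT STAY (hypotheses, WB3's list at rate `j`): `Z^{K_n}_{Λ_1} ≠ 0`; the cap at `sectorCount 0`; the names `ᾱ = Cα·M/β`, `κ̄ = √(2Cκe₀)`, `c̄r c̄c W̄ Z̄ σ̄ τ̄ ψ̄ Φ̄`
  (equational); the level-`0` datum's unit law at `(F_0, rate j)` (`A_b, Q_b`, `p ≥ 3`) and the Chernoff/import rows of its kit array; the five smallness rows; the
  block-`0` kit guard; the read-out names `A_ro Q_ro Q_tot A_tot` (equational).
This is the `p ≥ 3` half of the block-0 levels `1 ≤ j < d` of stub (b)'s weighted clause («WB4»); part 2 (`…TowerWtBlockZeroLevelsKlEng`) adds the four-leg cell,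
parity, nilpotency and the budget fit. Compositions of landed theorems and real algebra; nothing asserts (b), WT4, (ℓ), any stub, K3 or superconductivity.
References: BGM 2006 §2.8 (2.82)–(2.84), (2.93)–(2.98), Lemma 2.5 [cite: BenfattoGiulianiMastropietro2006].
-/

noncomputable section

namespace Summit.HubbardSuperconductivity.HubbardSuperconductivity.Theorems.EngineV8

set_option linter.dupNamespace false -- summit = problem name (single-conjunct summit), D-0017

open Classical
open Real Finset Literature.MathematicalPhysics.QuantumLattice Literature.Probability.LatticeModels GrassmannAlgebra
open Literature.MathematicalPhysics.QuantumLattice.FermiRG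
open Summit.HubbardSuperconductivity.HubbardSuperconductivity.Theorems.KLProgrammeLegKernels
open Summit.HubbardSuperconductivity.HubbardSuperconductivity.Theorems.KLRegimeSplit
open Summit.HubbardSuperconductivity.HubbardSuperconductivity.Theorems.KLRegimeWick
open Summit.HubbardSuperconductivity.HubbardSuperconductivity.Theorems.TwoPointAssembly
open Summit.HubbardSuperconductivity.HubbardSuperconductivity.Theorems.TorusFourierL2
open Summit.HubbardSuperconductivity.HubbardSuperconductivity.Theorems.DispersionFlow
open Literature.Probability.LatticeModels.BattleFederbush

variable {L M : ℕ} [NeZero L] [NeZero M]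

/-- **THE WEIGHTED UNIT LAW OF `𝒱_j[K_n]` AT `(F_j, rate j)`, BLOCK-0 LEVEL `1 ≤ j ≤ d`** («WB4» part 1; p3 g22's `baseLawWtF_blockZero_klEng` re-targeted — see the
module docstring): for every `p ≥ 3` and every pin, `klWtPinnedSum … (K_n) j (2p) q w / klLevUnitF β M 0 p j ≤ A_tot·λ^{p−1}·Q_tot^p`.
[cite: BenfattoGiulianiMastropietro2006, §2.8 (2.82)-(2.84), (2.93)-(2.98), Lemma 2.5 (2.98)] -/
theorem levelLawWt_blockZero_klEng (d : ℕ) (R : RenConsts) (c'' : ℝ) (hc'' : 0 < c'') :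
    ∃ Cinc Dinc : ℝ, 1 ≤ Cinc ∧ 1 ≤ Dinc ∧ ∃ Cκ CJ Cα : ℝ, 0 < Cκ ∧ 0 < CJ ∧ 0 < Cα ∧ (R.WF2 → ∃ c₃' : ℝ, 0 < c₃' ∧ ∃ U₀' : ℝ, 0 < U₀' ∧
      ∀ (G : GeoConsts) (P : SplitConsts) (Q : EngConsts) (c : ℝ), P.WF → 0 < c → c ≤ klEngC₃6 P R → c ≤ c₃' →
      ∀ μ ∈ klWindowC, ∀ U : ℝ, 0 < U → U ≤ klEngU₀9 P R c → U ≤ U₀' → c'' * U ≤ 1 →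
      ∀ β : ℝ, klBetaMin ≤ β → β ≤ Real.exp (c / U ^ 2) →
      ∀ (L M : ℕ) [NeZero L] [NeZero M], klEngL₃ β U ≤ L → klEngM₃ β U L ≤ M →
      ∀ n : ℕ, 1 ≤ n → n ≤ nScales β + 1 → IsKLRegime U c (-(n : ℤ)) →
        HistP klPredsV17F2 L M G P Q R β U μ 0 n → FrameOK R U (nScales β) μ (klFlowFrameU L M β U μ n) →
        (∀ m, 1 ≤ m → m < n → FlowPieceOscAt L M c'' β U μ m) →
      hubbardEffPartitionFnCT L M β U μ 0 (klFlowFrameU L M β U μ n) (klScale klE0 1) ≠ 0 →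
      ∀ jr D : ℕ, 1 ≤ jr → jr ≤ d → jr ≤ n → Fintype.card (SpaceTimeIdx L M × SectorLeg (sectorCount 0)) / 2 ≤ D →
      ∀ (lam Ab Qb : ℝ), 0 < lam → 0 ≤ Ab → 0 ≤ Qb →
      -- the decay name `ᾱ := Cα·M/β`, the pins and the kit names (equational binders)
      ∀ (αb κb crb ccb W Z σ τ ψ Φ : ℝ), αb = Cα * ((M : ℝ) / β) → κb = Real.sqrt (2 * Cκ * klE0) → crb = 81 * CJ * M / β → ccb = 162 * CJ * M / β →
        W = 32 * crb / ccb → Z = imagTimeWeight β M ^ 2 * ccb ^ 2 / 8 → σ = κb ^ 2 / ccb ^ 2 → τ = 4 * exp 4 * κb ^ 2 / ccb ^ 2 →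
        ψ = ccb ^ 2 / κb ^ 2 → Φ = exp 1 * αb * ccb / (κb ^ 2 * crb) →
      ∀ (A' Q' ι₁ ι₂ ι₃ : ℝ), 0 ≤ A' → 0 < Q' →
      -- the level-`0` weighted datum: its unit law at `(F_0, rate j)`, `p ≥ 3`
      (∀ p : ℕ, 3 ≤ p → klTowerMeasWtAt L M β U μ (klFlowFrameU L M β U μ n) 1 1 jr (2 * p) / klLevUnitF β M 0 p 0 ≤ Ab * lam ^ (p - 1) * Qb ^ p) →
      -- its Chernoff / import rows in the kit's scaled array, at `λ`
      (∀ m, 4 ≤ m → m ≤ D → W * Z ^ m * (klTowerMeasWtAt L M β U μ (klFlowFrameU L M β U μ n) 1 1 jr (2 * m) / klLevUnitF β M 0 m 0) ≤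
          A' * lam ^ (m - 1) * Q' ^ m) →
      W * Z ^ 3 * (klTowerMeasWtAt L M β U μ (klFlowFrameU L M β U μ n) 1 1 jr (2 * 3) / klLevUnitF β M 0 3 0) ≤ ι₃ * lam ^ 2 →
      W * Z ^ 1 * (klTowerMeasWtAt L M β U μ (klFlowFrameU L M β U μ n) 1 1 jr (2 * 1) / klLevUnitF β M 0 1 0) ≤ ι₁ * lam →
      W * Z ^ 2 * (klTowerMeasWtAt L M β U μ (klFlowFrameU L M β U μ n) 1 1 jr (2 * 2) / klLevUnitF β M 0 2 0) ≤ ι₂ * lam →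
      -- the five smallness rows and the block-`0` kit guard
      4 * σ * lam * Q' < 1 → 2 * lam * τ * Q' ≤ 1 → exp 1 * τ * lam * Q' < 1 →
      Φ * (τ * (ι₁ * lam + ι₂ / (2 * Q') + ι₃ / (4 * Q' ^ 2) + A' * Q' / 4)) < 1 →
      Φ * (exp 1 * τ * (ι₁ * lam) + (exp 1 * τ) ^ 2 * (ι₂ * lam) + (exp 1 * τ) ^ 3 * (ι₃ * lam ^ 2) +
        A' * (exp 1 * τ * Q') * ((exp 1 * τ * lam * Q') ^ 3 / (1 - exp 1 * τ * lam * Q'))) < 1 →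
      Φ * towerV D τ (fun m => W * Z ^ m * (klTowerMeasWtAt L M β U μ (klFlowFrameU L M β U μ n) 1 1 jr (2 * m) / klLevUnitF β M 0 m 0)) < 1 →
      -- the read-out constants (equational binders)
      ∀ (Aro Qro Qtot Atot : ℝ), Aro = Cinc * Ab → Qro = Dinc * Qb → Qtot = Dinc * max 1 (max Qro (max (4 * Q') (2 * τ * ψ * Q'))) →
        Atot = Aro + Cinc * (A' * (4 * σ * lam * Q' / (1 - 4 * σ * lam * Q')) +
          exp 1 * (τ * (ι₁ * lam + ι₂ / (2 * Q') + ι₃ / (4 * Q' ^ 2) + A' * Q' / 4)) *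
            (Φ * (τ * (ι₁ * lam + ι₂ / (2 * Q') + ι₃ / (4 * Q' ^ 2) + A' * Q' / 4)) /
              (1 - Φ * (τ * (ι₁ * lam + ι₂ / (2 * Q') + ι₃ / (4 * Q' ^ 2) + A' * Q' / 4)))) / (2 * τ * Q')) →
      ∀ p : ℕ, 3 ≤ p → ∀ (q : Fin (2 * p)) (w : SpaceTimeIdx L M × SectorLeg (sectorCount jr)),
        klWtPinnedSum L M β U μ (klFlowFrameU L M β U μ n) jr (2 * p) q w / klLevUnitF β M 0 p jr ≤ Atot * lam ^ (p - 1) * Qtot ^ p) := by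
  obtain ⟨C₁, C₂, hC₁, hC₂, hJ⟩ := klWtPinnedSumAt_jump_le_klEng_flow_all_uniform R c'' hc''.le
  obtain ⟨Cκ, Cb, CJ₀, hCκ, hCb, hCJ₀, hG⟩ := linkDataBlockZeroF_klEng d R c'' hc''
  obtain ⟨CJ, hCJ, hO⟩ := overlapWt_towerBlock_klEng_flow_all 1 R c'' hc''.le
  obtain ⟨Cα, hCα, hA⟩ := alphaWt_blockZero_of_doors d R
  have hC₂'1 : (1 : ℝ) ≤ max 1 C₂ := le_max_left _ _
  refine ⟨max 1 C₁, max 1 C₂ ^ 2, le_max_left _ _, one_le_pow₀ hC₂'1, Cκ, CJ, Cα, hCκ, hCJ, hCα, fun hR2 => ?_⟩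
  obtain ⟨c₃', hc₃'0, U₀', hU₀'0, hJ'⟩ := hJ hR2
  refine ⟨c₃', hc₃'0, U₀', hU₀'0, ?_⟩
  intro G P Q c hP hc hc6 hc₃' μ hμ U hU hU9 hU₀' hcU β hβmin hβc L M _ _ hL3 hM3 n hn1 hnN hkl hhist hK hosc hZ1 jr D hjr1 hjrd hjrn hD
    lam Ab Qb hlam hAb hQb αb κb crb ccb W Z σ τ ψ Φ hαb hκb hcrb hccb hW hZ hσ hτ hψ hΦ A' Q' ι₁ ι₂ ι₃ hA'0 hQ'0
    hlawb hprof hprof3 himp₁ himp₂ hx₁ hx₂ hx₃ hy hθ hguard Aro Qro Qtot Atot hAro hQro hQtot hAtot p hp q w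
  obtain ⟨q', rfl⟩ : ∃ q', p = q' + 1 := ⟨p - 1, by omega⟩
  have hβ : 0 < β := KLRegimeSplit.pos_of_klBetaMin_le hβmin
  have hU3 : U ≤ min (klEngU₀3 P R c) (1 / (R.Gfr 3 + 1)) :=
    le_min (hU9.trans (klEngU₀9_le_klEngU₀3 P R c)) (hU9.trans (klEngU₀9_le_inv_gfr_add_one P hR2.wf c (by norm_num)))
  -- the weighted decay rows of the block-0 slice `(Λ_{j_r}, Λ_1]` at rate `j_r` (p3's `alphaWt_blockZero_of_doors`), `α := ᾱ := Cα·M/β`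
  obtain ⟨hrowα, hcolα⟩ := hA P c hR2 hc hc6 U hU hU9 β hβmin hβc μ (klFlowFrameU L M β U μ n) hK L M hL3 hM3 jr hjr1 hjrd jr
  have hααb : Cα * ((M : ℝ) / β) ≤ αb * 4 := by
    rw [hαb]; have : 0 ≤ Cα * ((M : ℝ) / β) := by positivity
    linarith
  set K : TrigPolyC4v := klFlowFrameU L M β U μ n with hKdef
  have he0 : (0 : ℝ) < klE0 := by norm_num [klE0]
  have hε : 0 < imagTimeWeight β M := imagTimeWeight_pos_of_pos (M := M) hβ
  have hM0 : (0 : ℝ) < M := Nat.cast_pos.2 (Nat.pos_of_ne_zero (NeZero.ne M))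
  -- positivity of the pins and names
  have hκb0 : 0 < κb := by rw [hκb]; exact Real.sqrt_pos.2 (by positivity)
  have hαb0 : 0 < αb := by rw [hαb]; positivity
  have hcrb0 : 0 < crb := by rw [hcrb]; positivity
  have hccb0 : 0 < ccb := by rw [hccb]; positivity
  have hW0 : 0 < W := by rw [hW]; positivity
  have hZ0 : 0 < Z := by rw [hZ]; positivity
  have hσ0 : 0 ≤ σ := by rw [hσ]; positivity
  have hτ0 : 0 < τ := by rw [hτ]; positivity
  have hψ0 : 0 ≤ ψ := by rw [hψ]; positivity
  have hΦ0 : 0 ≤ Φ := by rw [hΦ]; positivity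
  -- the read-out constants
  set Cinc : ℝ := max 1 C₁ with hCincdef
  set Dinc : ℝ := max 1 C₂ ^ 2 with hDincdef
  have hCinc1 : 1 ≤ Cinc := le_max_left _ _
  have hCinc0 : 0 < Cinc := lt_of_lt_of_le one_pos hCinc1
  have hDinc1 : 1 ≤ Dinc := one_le_pow₀ hC₂'1
  have hDinc0 : 0 < Dinc := lt_of_lt_of_le one_pos hDinc1
  have hAro0 : 0 ≤ Aro := by rw [hAro]; positivity
  have hQro0 : 0 ≤ Qro := by rw [hQro]; positivity
  -- the jump constant against the floor-unit gain: `C₁·C₂^{2p−1}·((2^{p−3})⁻¹)^Δ ≤ C_inc·D_inc^p`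
  have hCD : ∀ Δ : ℕ, C₁ * C₂ ^ (2 * (q' + 1) - 1) * (((2 : ℝ) ^ (q' + 1 - 3))⁻¹) ^ Δ ≤ Cinc * Dinc ^ (q' + 1) := by
    intro Δ
    have hg : (((2 : ℝ) ^ (q' + 1 - 3))⁻¹) ^ Δ ≤ 1 := pow_le_one₀ (by positivity) (inv_le_one_of_one_le₀ (one_le_pow₀ (by norm_num)))
    have h1 : C₁ ≤ Cinc := le_max_right _ _
    have h2 : C₂ ^ (2 * (q' + 1) - 1) ≤ Dinc ^ (q' + 1) :=
      calc C₂ ^ (2 * (q' + 1) - 1) ≤ (max 1 C₂) ^ (2 * (q' + 1) - 1) := pow_le_pow_left₀ hC₂.le (le_max_right _ _) _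
        _ ≤ (max 1 C₂) ^ (2 * (q' + 1)) := pow_le_pow_right₀ hC₂'1 (by omega)
        _ = Dinc ^ (q' + 1) := by rw [hDincdef, ← pow_mul, mul_comm]
    calc C₁ * C₂ ^ (2 * (q' + 1) - 1) * (((2 : ℝ) ^ (q' + 1 - 3))⁻¹) ^ Δ ≤ C₁ * C₂ ^ (2 * (q' + 1) - 1) * 1 :=
          mul_le_mul_of_nonneg_left hg (by positivity)
      _ ≤ Cinc * Dinc ^ (q' + 1) := by rw [mul_one]; exact mul_le_mul h1 h2 (by positivity) (by positivity)
  have hCD1 : (1 : ℝ) ≤ Cinc * Dinc ^ (q' + 1) := one_le_mul_of_one_le_of_one_le hCinc1 (one_le_pow₀ hDinc1)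
  -- the kit array of the level-`0` datum
  set μk : ℕ → ℝ := fun m => W * Z ^ m * (klTowerMeasWtAt L M β U μ K 1 1 jr (2 * m) / klLevUnitF β M 0 m 0) with hμk
  have hμ0 : ∀ m, 0 ≤ μk m := fun m =>
    mul_nonneg (by positivity) (div_nonneg (klTowerMeasWtAt_nonneg hβ.le U μ K 1 1 jr _) (klLevUnitF_pos hβ 0 m 0).le)
  have hV0 : 0 ≤ towerV D τ μk := towerV_nonneg hτ0.le hμ0
  have hkit0 : ∀ (N q : ℕ), Φ * towerV D τ μk < 1 →
      0 ≤ towerFO D σ μk q + ∑ n' ∈ Icc 2 N, exp 1 * Φ ^ (n' - 1) * ψ ^ q * towerS D τ μk n' q +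
        ψ ^ q * exp 1 * towerV D τ μk * (Φ * towerV D τ μk) ^ N / (1 - Φ * towerV D τ μk) := by
    intro N q hg
    have h1 : 0 ≤ towerFO D σ μk q := towerFO_nonneg hσ0 hμ0 q
    have h2 : 0 ≤ ∑ n' ∈ Icc 2 N, exp 1 * Φ ^ (n' - 1) * ψ ^ q * towerS D τ μk n' q :=
      sum_nonneg fun n' _ => by have := towerS_nonneg (D := D) hτ0.le hμ0 n' q; positivity
    have h3 : 0 ≤ ψ ^ q * exp 1 * towerV D τ μk * (Φ * towerV D τ μk) ^ N / (1 - Φ * towerV D τ μk) :=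
      div_nonneg (by positivity) (sub_nonneg.2 hg.le)
    linarith
  -- the block-`0` data on `K_n`: Gram (rate-free) and the weighted overlaps of `E(F_1)·S(F̃_0)`
  obtain ⟨hκ0, hκκ, hGB, -, -, -, -, -⟩ :=
    hG G P Q c hP hR2 hc hc6 μ hμ U hU hU9 hcU β hβmin hβc L M hL3 hM3 n hn1 hnN hkl hhist hK hosc jr hjr1 hjrd hjrn
  obtain ⟨hovR, hovC⟩ :=
    hO G P Q c hR2 hc hc6 μ hμ U hU hU3 hcU β hβmin hβc L M hL3 hM3 n hn1 hnN hkl hhist hosc 1 (by norm_num) (by omega) jr (by omega)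
  have hκκb : Real.sqrt (Cκ * (klScale klE0 1 / klScale klE0 0) * (klE0 * ((8 : ℝ) ^ 0)⁻¹)) ^ 2 * (8 : ℝ) ^ (1 * 1) ≤ κb ^ 2 := by
    rw [hκb]; simpa using hκκ
  have hααb' : Cα * ((M : ℝ) / β) ≤ αb * (4 : ℝ) ^ (1 * 1) := by simpa using hααb
  have hcol162 : (81 : ℝ) * 2 ^ (1 * 1 - (1 * 1 - 1)) * CJ * M / β = 162 * CJ * M / β := by norm_num
  have hovR' : ∀ X'' : SpaceTimeIdx L M × SectorLeg (sectorCount (1 * 1)), ∑ X' : SpaceTimeIdx L M × SectorLeg (sectorCount (1 * 1 - 1)),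
      ‖(sectorAnalysisMatrix L M β (klAnisoFamily L M β μ K klE0 (1 * 1)) *
        sectorSubMatrix L M β (bgmFatMultiplier L M klE0 β (nambuXiCT L μ K) (1 * 1 - 1))) X'' X'‖ *
        klScaleWt L M β jr {latticeLegPos (2 * (2 * M)) X'', latticeLegPos (2 * (2 * M)) X'} ≤ crb :=
    fun X'' => (hovR X'').trans_eq hcrb.symm
  have hovC' : ∀ X' : SpaceTimeIdx L M × SectorLeg (sectorCount (1 * 1 - 1)), ∑ X'' : SpaceTimeIdx L M × SectorLeg (sectorCount (1 * 1)),
      ‖(sectorAnalysisMatrix L M β (klAnisoFamily L M β μ K klE0 (1 * 1)) *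
        sectorSubMatrix L M β (bgmFatMultiplier L M klE0 β (nambuXiCT L μ K) (1 * 1 - 1))) X'' X'‖ *
        klScaleWt L M β jr {latticeLegPos (2 * (2 * M)) X'', latticeLegPos (2 * (2 * M)) X'} ≤ ccb :=
    fun X' => (hovC X').trans_eq (hcol162.trans hccb.symm)
  have hguard' : exp 1 * αb * ccb / (κb ^ 2 * crb) * towerV D (4 * exp 4 * κb ^ 2 / ccb ^ 2)
      (fun m => 32 * crb / ccb * (imagTimeWeight β M ^ 2 * ccb ^ 2 / 8) ^ m *
        (klTowerMeasWtAt L M β U μ K 1 1 jr (2 * m) / klLevUnitF β M 0 m (1 * 1 - 1))) < 1 := by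
    simpa only [hμk, hΦ, hτ, hW, hZ] using hguard
  -- the born partial increment `𝒱_{j_r} − 𝒱_1` at `F_1`, every pin, in floor units (WB1 at `(1,1,j_r,1)`)
  have hborn : ∀ N : ℕ, 2 ≤ N → Φ * towerV D τ μk < 1 →
      ∀ (i : Fin (2 * (q' + 1))) (w'' : SpaceTimeIdx L M × SectorLeg (sectorCount 1)),
      klWtPinnedSumAt L M β μ K 1 jr (2 * (q' + 1)) (klEffectiveAction L M β U μ K klE0 jr - klTowerInput L M β U μ K 1 1) i w'' ≤
        (towerFO D σ μk (q' + 1) + ∑ n' ∈ Icc 2 N, exp 1 * Φ ^ (n' - 1) * ψ ^ (q' + 1) * towerS D τ μk n' (q' + 1) +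
          ψ ^ (q' + 1) * exp 1 * towerV D τ μk * (Φ * towerV D τ μk) ^ N / (1 - Φ * towerV D τ μk)) * klLevUnitF β M 0 (q' + 1) 1 := by
    intro N hN hg i w''
    have h := klWtPinnedSumAt_partialIncr_le_kitStep_of_bounds (L := L) (M := M) (d := 1) (k := 1) (J' := 1) (J₂ := jr) hβ U μ K jr
      le_rfl le_rfl (by norm_num) (by omega) hZ1 hκ0 hκb0 hκκb hGB hαb0 hααb' hrowα hcolα hcrb0 hccb0 hovR' hovC' hD (by omega : 1 ≤ N)
      hguard' q' i w''
    rw [← hW, ← hZ, ← hτ, ← hσ, ← hψ, ← hΦ] at h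
    exact (div_le_iff₀ (klLevUnitF_pos hβ 0 (q' + 1) _)).1 h
  -- the jump to `F_{j_r}` in degree `2p`, rate `j_r`
  have h2p : 2 * (q' + 1) - 1 + 1 = 2 * (q' + 1) := by omega
  have h2p' : 2 * (q' + 1) - 1 - 1 = 2 * (q' + 1) - 2 := by omega
  have hjump : ∀ k : ℕ, k + 1 ≤ jr → ∀ T : HubbardGrassmann L M,
      (∀ (m' : ℕ) (X : Fin m' → HubbardFieldIdx L M), ∑ i, signedMomentum L (X i).2 (X i).1.1.2 ≠ 0 → kernel ℂ T m' X = 0) →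
      ∀ (q : Fin (2 * (q' + 1))) (w : SpaceTimeIdx L M × SectorLeg (sectorCount jr)) (N : ℝ), 0 ≤ N →
        (∀ w' : SpaceTimeIdx L M × SectorLeg (sectorCount k), klWtPinnedSumAt L M β μ K k jr (2 * (q' + 1)) T q w' ≤ N) →
        klWtPinnedSumAt L M β μ K jr jr (2 * (q' + 1)) T q w ≤
          C₁ * C₂ ^ (2 * (q' + 1) - 1) * ((2 : ℝ) ^ (jr - k)) ^ (2 * (q' + 1) - 2) * N := by
    intro k hk T hT
    have h := hJ' (2 * (q' + 1) - 1) G P Q c hc hc6 hc₃' μ hμ U hU hU3 hU₀' hcU β hβmin hβc L M hL3 hM3 n hn1 hnN hkl hhist hosc k jr hk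
      hjrn T hT jr le_rfl
    rw [h2p, h2p'] at h
    exact h
  -- the jump factor against the floor-unit ratio: a pure gain
  have hunit : ∀ a : ℕ, a ≤ jr → ∀ C X : ℝ,
      C * ((2 : ℝ) ^ (jr - a)) ^ (2 * (q' + 1) - 2) * X / klLevUnitF β M 0 (q' + 1) jr =
        C * (((2 : ℝ) ^ (q' + 1 - 3))⁻¹) ^ (jr - a) * (X / klLevUnitF β M 0 (q' + 1) a) := by
    intro a ha C X
    obtain ⟨Δ, hΔ⟩ := Nat.exists_eq_add_of_le ha
    have hu0 := klLevUnitF_pos hβ (M := M) 0 (q' + 1) a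
    have hr0 := klLevRatioF_pos 0 (q' + 1)
    rw [hΔ, Nat.add_sub_cancel_left, klLevUnitF_add, ← pow_mul, mul_comm Δ (2 * (q' + 1) - 2), pow_mul,
      ← jumpW_div_klLevRatioF_eq hp, div_pow]
    field_simp
  have hu : 0 < klLevUnitF β M 0 (q' + 1) jr := klLevUnitF_pos hβ 0 _ _
  -- (5)'s bracket data
  set Yl : ℝ := ι₁ * lam + ι₂ / (2 * Q') + ι₃ / (4 * Q' ^ 2) + A' * Q' / 4 with hYl
  have hι₁0 : 0 ≤ ι₁ := by
    have h1 : 0 ≤ ι₁ * lam := (hμ0 1).trans himp₁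
    rw [mul_comm] at h1
    exact nonneg_of_mul_nonneg_right h1 hlam
  have hι₂0 : 0 ≤ ι₂ := by
    have h1 : 0 ≤ ι₂ * lam := (hμ0 2).trans himp₂
    rw [mul_comm] at h1
    exact nonneg_of_mul_nonneg_right h1 hlam
  have hι₃0 : 0 ≤ ι₃ := by
    have h1 : 0 ≤ ι₃ * lam ^ 2 := (hμ0 3).trans hprof3
    rw [mul_comm] at h1
    exact nonneg_of_mul_nonneg_right h1 (by positivity)
  have hYl0 : 0 ≤ Yl := by positivity
  have hTY : 0 ≤ τ * Yl := by positivity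
  have hx10 : 0 ≤ 4 * σ * lam * Q' / (1 - 4 * σ * lam * Q') := div_nonneg (by positivity) (sub_nonneg.2 hx₁.le)
  have hYy : 0 ≤ Φ * (τ * Yl) / (1 - Φ * (τ * Yl)) := div_nonneg (by positivity) (sub_nonneg.2 hy.le)
  have hbr := readoutBracket_le_law_mul_sharp hAro0 hQro0 hA'0 hQ'0 hψ0 hτ0 hx10 hTY hYy hCinc0.le hDinc1 (by omega : 1 ≤ q' + 1)
  -- per pin of `F_{j_r}`
  have hpin : klWtPinnedSumAt L M β μ K jr jr (2 * (q' + 1)) (klEffectiveAction L M β U μ K klE0 jr) q w / klLevUnitF β M 0 (q' + 1) jr ≤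
        Atot * lam ^ (q' + 1 - 1) * Qtot ^ (q' + 1) := by
    -- `𝒱_{j_r} = 𝒱_1 + (𝒱_{j_r} − 𝒱_1)`
    have hsplitV : klEffectiveAction L M β U μ K klE0 jr =
        klTowerInput L M β U μ K 1 1 + (klEffectiveAction L M β U μ K klE0 jr - klTowerInput L M β U μ K 1 1) := by abel
    have hpub : klWtPinnedSumAt L M β μ K jr jr (2 * (q' + 1)) (klEffectiveAction L M β U μ K klE0 jr) q w / klLevUnitF β M 0 (q' + 1) jr ≤
        klWtPinnedSumAt L M β μ K jr jr (2 * (q' + 1)) (klTowerInput L M β U μ K 1 1) q w / klLevUnitF β M 0 (q' + 1) jr +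
          klWtPinnedSumAt L M β μ K jr jr (2 * (q' + 1)) (klEffectiveAction L M β U μ K klE0 jr - klTowerInput L M β U μ K 1 1) q w /
            klLevUnitF β M 0 (q' + 1) jr := by
      rw [← add_div]
      refine div_le_div_of_nonneg_right ?_ hu.le
      conv_lhs => rw [hsplitV]
      exact klWtPinnedSumAt_add_le hβ.le μ K jr jr (2 * (q' + 1)) _ _ q w
    -- (1) the level-`0` datum jumped from `F_0`
    have hro : klWtPinnedSumAt L M β μ K jr jr (2 * (q' + 1)) (klTowerInput L M β U μ K 1 1) q w / klLevUnitF β M 0 (q' + 1) jr ≤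
        Aro * lam ^ (q' + 1 - 1) * Qro ^ (q' + 1) := by
      have hj := hjump 0 (by omega) (klTowerInput L M β U μ K 1 1)
        (fun m' X hX => klEffectiveAction_momentumConserving β U μ K klE0 _ m' X hX) q w
        (klTowerMeasWtAt L M β U μ K 1 1 jr (2 * (q' + 1))) (klTowerMeasWtAt_nonneg hβ.le U μ K 1 1 jr _)
        (fun w' => klWtPinnedSumAt_le_klTowerMeasWtAt β U μ K 1 1 jr (2 * (q' + 1)) q w')
      refine (div_le_div_of_nonneg_right hj hu.le).trans ?_
      rw [hunit 0 (by omega)]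
      calc C₁ * C₂ ^ (2 * (q' + 1) - 1) * (((2 : ℝ) ^ (q' + 1 - 3))⁻¹) ^ (jr - 0) *
            (klTowerMeasWtAt L M β U μ K 1 1 jr (2 * (q' + 1)) / klLevUnitF β M 0 (q' + 1) 0)
          ≤ Cinc * Dinc ^ (q' + 1) * (Ab * lam ^ (q' + 1 - 1) * Qb ^ (q' + 1)) :=
            mul_le_mul (hCD _) (hlawb (q' + 1) hp)
              (div_nonneg (klTowerMeasWtAt_nonneg hβ.le U μ K 1 1 jr _) (klLevUnitF_pos hβ 0 (q' + 1) 0).le) (by positivity)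
        _ = Aro * lam ^ (q' + 1 - 1) * Qro ^ (q' + 1) := by rw [hAro, hQro, mul_pow]; ring
    -- (2) the born partial increment: at `F_1`, jumped for `j_r ≥ 2`, read directly for `j_r = 1`
    have hincj : ∀ N : ℕ, 2 ≤ N → Φ * towerV D τ μk < 1 →
        klWtPinnedSumAt L M β μ K jr jr (2 * (q' + 1)) (klEffectiveAction L M β U μ K klE0 jr - klTowerInput L M β U μ K 1 1) q w /
            klLevUnitF β M 0 (q' + 1) jr ≤
          Cinc * Dinc ^ (q' + 1) * (towerFO D σ μk (q' + 1) + ∑ n' ∈ Icc 2 N, exp 1 * Φ ^ (n' - 1) * ψ ^ (q' + 1) * towerS D τ μk n' (q' + 1) +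
            ψ ^ (q' + 1) * exp 1 * towerV D τ μk * (Φ * towerV D τ μk) ^ N / (1 - Φ * towerV D τ μk)) := by
      intro N hN hg
      have hk0 := hkit0 N (q' + 1) hg
      have hb := hborn N hN hg
      by_cases hd3 : 1 + 1 ≤ jr
      · have hj := hjump 1 hd3 (klEffectiveAction L M β U μ K klE0 jr - klTowerInput L M β U μ K 1 1)
          (partialIncr_momentumConserving β U μ K 1 1 jr) q w _ (mul_nonneg hk0 (klLevUnitF_pos hβ 0 (q' + 1) 1).le) (fun w' => hb q w')
        refine (div_le_div_of_nonneg_right hj hu.le).trans ?_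
        rw [hunit 1 (by omega), mul_div_cancel_right₀ _ (klLevUnitF_pos hβ 0 (q' + 1) 1).ne']
        exact mul_le_mul_of_nonneg_right (hCD _) hk0
      · obtain rfl : jr = 1 := by omega
        have h1 := hb q w
        refine (div_le_div_of_nonneg_right h1 hu.le).trans ?_
        rw [mul_div_cancel_right₀ _ (klLevUnitF_pos hβ 0 (q' + 1) 1).ne']
        exact le_mul_of_one_le_left hk0 hCD1
    -- (3) E1 part 7 and the bracket under one law
    have hfit := towerReadout_le_of_ro_mul (D := D) (μ := μk) hσ0 hΦ0 hψ0 hτ0 hlam hA'0 hQ'0 hCinc0 hDinc0 hμ0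
      himp₁ himp₂ hprof3 hprof hx₁ hx₂ hx₃ hy hθ hp hpub hro hincj
    refine hfit.trans ?_
    rw [hAtot, hQtot]
    calc lam ^ (q' + 1 - 1) * (Aro * Qro ^ (q' + 1) + Cinc * Dinc ^ (q' + 1) *
            (A' * (4 * Q') ^ (q' + 1) * (4 * σ * lam * Q' / (1 - 4 * σ * lam * Q')) +
              exp 1 * ψ * (2 * τ * ψ * Q') ^ (q' + 1 - 1) * (τ * Yl) * (Φ * (τ * Yl) / (1 - Φ * (τ * Yl)))))
        ≤ lam ^ (q' + 1 - 1) * ((Aro + Cinc * (A' * (4 * σ * lam * Q' / (1 - 4 * σ * lam * Q')) +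
              exp 1 * (τ * Yl) * (Φ * (τ * Yl) / (1 - Φ * (τ * Yl))) / (2 * τ * Q'))) *
            (Dinc * max 1 (max Qro (max (4 * Q') (2 * τ * ψ * Q')))) ^ (q' + 1)) :=
          mul_le_mul_of_nonneg_left hbr (by positivity)
      _ = (Aro + Cinc * (A' * (4 * σ * lam * Q' / (1 - 4 * σ * lam * Q')) +
              exp 1 * (τ * Yl) * (Φ * (τ * Yl) / (1 - Φ * (τ * Yl))) / (2 * τ * Q'))) *
            lam ^ (q' + 1 - 1) * (Dinc * max 1 (max Qro (max (4 * Q') (2 * τ * ψ * Q')))) ^ (q' + 1) := by ring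
  -- (4) the pin IS the weighted pinned sum of `𝒱_{j_r}[K_n]` at `(F_{j_r}, rate j_r)`
  rw [← klWtPinnedSumOf_klEffectiveAction, ← klWtPinnedSumAt_self]
  exact hpin

end Summit.HubbardSuperconductivity.HubbardSuperconductivity.Theorems.EngineV8

end
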